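import Summits.QuantumFields.YangMills.Theorems.ToronValleyVolumeLojasiewiczLocaliseSeam
import Summits.QuantumFields.YangMills.Theorems.VirialFluxGapDeficitForm
import Summits.QuantumFields.YangMills.Theorems.LuscherReductionTwistedTraceScalingBTTauBudget
import HarnessLib

/-!
# Polynomial Łojasiewicz localisation of the periodic deficit, III: the deficit as a sum of squares, per-link consequences, gauge bookkeeping
# (helper file for the crux `ToronValleyVolume.LojasiewiczLocalise`, item stmt-QuantumFields-24498, LINE g15-B of ym-idea-4)

* §1 ★ `ringDeficit_eq_sums` — `F_z(P) = Σ_{i<2L−1} (6L³ − timeCoupling(P_i,P_{i+1})) + (6L³ − timeCoupling(P_last, g·τ_z P₀)) + Σ ½(S_i + S_{i+1}) + ½(S_last + S(g·τ_zP₀))`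
  (✓`log_seamChain_one`, ✓`log_transferKernel_one`), every summand non-negative; `6L³ − timeCoupling(U,V) = Σ_e ‖q U_e − q V_e‖²` (`timeCoupling_deficit_eq`); hence each kinetic
  bond deficit, the seam deficit and `½·S(P₀)` are at most `F₀(P)` (`kinetic_le_ringDeficit`, `seam_le_ringDeficit`, `wilsonAction_first_le_ringDeficit`).
* §2 per link: consecutive slices are `2√F₀`-close in Frobenius distance (`fd_step_le`), every slice is within `4L√F₀` of slice `0` (`fd_slice_zero_le'`), the seam gauge
  field moves slice `0` by at most `4L√F₀` (`fd_seam_zero_le`), and `√(2S(P₀)) ≤ 2√F₀`.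
* §3 `fd_gaugeTransform_apply` (per-link gauge invariance of `fd`), `gaugeTransform_conj_eq` (`(tgt⁻¹)·(t·U) = t·(g·U)`), `wrapEdge_shift` / `wrapReps_eq` (the three wrap
  representatives of ✓`wrapReps` sit on edges ending at the origin).
HONEST FRAMING: bookkeeping; the crux is assembled in `…ToronValleyVolumeLojasiewiczLocalise`; ⟨24497⟩, the leaf `PeriodicSoftness` and Yang–Mills stay OPEN.  THEOREMS ONLY
(no definition, no `sorry`).
-/

set_option autoImplicit false

noncomputable section

open scoped Quaternion Matrix BigOperators
open Literature.MathematicalPhysics.QuantumFieldTheory hiding SU2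
open Literature.MathematicalPhysics.QuantumLattice

namespace Summit.QuantumFields.YangMills.Theorems.ToronValleyVolume.Lojasiewicz

open Summit.QuantumFields.YangMills.Theorems.FemtoTransferGap
open Summit.QuantumFields.YangMills.Theorems.FemtoTransferGap.TT
open Summit.QuantumFields.YangMills.Theorems.FemtoTransferGap.TT.SectorSmooth
open Summit.QuantumFields.YangMills.Theorems.FemtoTransferGap.TwoLattice
open Summit.QuantumFields.YangMills.Theorems.FemtoTransferGap.TwoLattice.Flat
open Summit.QuantumFields.YangMills.Theorems.FemtoTransferGap.TwoLattice.Cov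
open Summit.QuantumFields.YangMills.Theorems.VirialFluxGap.RingDeficit

variable {L : ℕ} [NeZero L]
/-! ## §1 The deficit as a sum of squares -/

/-- The kinetic bond deficit is a sum of squared quaternion distances: `6L³ − timeCoupling(U,V) = Σ_e ‖q(U_e) − q(V_e)‖²`. [cite: MontvayMunster1994, §3.2.3 (3.97)] -/
theorem timeCoupling_deficit_eq (U V : GaugeConfig 3 L SU2) :
    6 * (L : ℝ) ^ 3 - timeCoupling su2Rep U V = ∑ e : Edge 3 L, ‖su2Quat (U e) - su2Quat (V e)‖ ^ 2 := by
  unfold timeCoupling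
  have h : ∀ e : Edge 3 L, ‖su2Quat (U e) - su2Quat (V e)‖ ^ 2 = 2 - ((su2Rep (U e * (V e)⁻¹)).trace).re := fun e => by
    rw [ConstTube.re_trace_su2Rep_mul_inv_eq_norm]; ring
  simp only [h, Finset.sum_sub_distrib, Finset.sum_const, Finset.card_univ, nsmul_eq_mul, ConstTube.card_edge_three L]
  ring

/-- A single link's squared distance is at most the bond deficit. [folklore] -/
theorem norm_sq_le_timeCoupling_deficit (U V : GaugeConfig 3 L SU2) (e : Edge 3 L) :
    ‖su2Quat (U e) - su2Quat (V e)‖ ^ 2 ≤ 6 * (L : ℝ) ^ 3 - timeCoupling su2Rep U V := by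
  rw [timeCoupling_deficit_eq]
  exact Finset.single_le_sum (f := fun e : Edge 3 L => ‖su2Quat (U e) - su2Quat (V e)‖ ^ 2) (fun _ _ => sq_nonneg _) (Finset.mem_univ e)

/-- The bond deficit vanishes on equal slices. [folklore] -/
theorem timeCoupling_deficit_self (U : GaugeConfig 3 L SU2) : 6 * (L : ℝ) ^ 3 - timeCoupling su2Rep U U = 0 := by
  rw [timeCoupling_deficit_eq]; simp

/-- ★ **The deficit is a sum of non-negative squares**: `F_z(P) = Σ_{i<2L−1} D_i + D_seam + Σ_{i<2L−1} ½(S_i + S_{i+1}) + ½(S_last + S(g·τ_z P₀))`,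
`D = 6L³ − timeCoupling`. [cite: Luscher1983, §2] -/
theorem ringDeficit_eq_sums (z : Fin 3 → Bool) (P : (Fin (2 * L - 1 + 1) → GaugeConfig 3 L SU2) × (Site 3 L → SU2)) :
    ringDeficit L z P =
      (∑ i : Fin (2 * L - 1), (6 * (L : ℝ) ^ 3 - timeCoupling su2Rep (P.1 i.castSucc) (P.1 i.succ))) +
      (6 * (L : ℝ) ^ 3 - timeCoupling su2Rep (P.1 (Fin.last (2 * L - 1))) (gaugeTransform P.2 (twist3 z (P.1 0)))) +
      (∑ i : Fin (2 * L - 1), (1 / 2 : ℝ) * (wilsonAction su2Rep (P.1 i.castSucc) + wilsonAction su2Rep (P.1 i.succ))) +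
      (1 / 2 : ℝ) * (wilsonAction su2Rep (P.1 (Fin.last (2 * L - 1))) + wilsonAction su2Rep (gaugeTransform P.2 (twist3 z (P.1 0)))) := by
  unfold ringDeficit
  rw [ringExponent_eq, log_seamChain_one, log_transferKernel_one]
  rw [Finset.sum_congr rfl (fun i _ => log_transferKernel_one (P.1 (Fin.castSucc i)) (P.1 (Fin.succ i)))]
  have hL1 : 1 ≤ L := NeZero.one_le
  have hN : (((2 * L - 1 : ℕ) : ℝ) + 1) = 2 * (L : ℝ) := by
    rw [Nat.cast_sub (by omega), Nat.cast_mul]; push_cast; ring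
  have h12 : 12 * (L : ℝ) ^ 4 = (∑ _i : Fin (2 * L - 1), 6 * (L : ℝ) ^ 3) + 6 * (L : ℝ) ^ 3 := by
    rw [Finset.sum_const, Finset.card_univ, Fintype.card_fin, nsmul_eq_mul]
    have : 12 * (L : ℝ) ^ 4 = (((2 * L - 1 : ℕ) : ℝ) + 1) * (6 * (L : ℝ) ^ 3) := by rw [hN]; ring
    rw [this]; ring
  have key : (∑ i : Fin (2 * L - 1), (6 * (L : ℝ) ^ 3 - timeCoupling su2Rep (P.1 i.castSucc) (P.1 i.succ))) +
      (∑ i : Fin (2 * L - 1), (1 / 2 : ℝ) * (wilsonAction su2Rep (P.1 i.castSucc) + wilsonAction su2Rep (P.1 i.succ))) =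
      (∑ _i : Fin (2 * L - 1), 6 * (L : ℝ) ^ 3) -
        ∑ i : Fin (2 * L - 1), (timeCoupling su2Rep (P.1 i.castSucc) (P.1 i.succ) -
          (1 / 2 : ℝ) * (wilsonAction su2Rep (P.1 i.castSucc) + wilsonAction su2Rep (P.1 i.succ))) := by
    rw [← Finset.sum_add_distrib, ← Finset.sum_sub_distrib]
    exact Finset.sum_congr rfl fun i _ => by ring
  rw [h12]
  linarith [key]

/-- Each kinetic bond deficit is at most the total deficit (`z = 0`). [folklore] -/
theorem kinetic_le_ringDeficit (P : (Fin (2 * L - 1 + 1) → GaugeConfig 3 L SU2) × (Site 3 L → SU2)) (i : Fin (2 * L - 1)) :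
    6 * (L : ℝ) ^ 3 - timeCoupling su2Rep (P.1 i.castSucc) (P.1 i.succ) ≤ ringDeficit L (fun _ => false) P := by
  rw [ringDeficit_eq_sums]
  have hA : 6 * (L : ℝ) ^ 3 - timeCoupling su2Rep (P.1 i.castSucc) (P.1 i.succ) ≤
      ∑ i : Fin (2 * L - 1), (6 * (L : ℝ) ^ 3 - timeCoupling su2Rep (P.1 i.castSucc) (P.1 i.succ)) :=
    Finset.single_le_sum (f := fun i : Fin (2 * L - 1) => 6 * (L : ℝ) ^ 3 - timeCoupling su2Rep (P.1 i.castSucc) (P.1 i.succ))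
      (fun j _ => by linarith [timeCoupling_su2Rep_le (P.1 j.castSucc) (P.1 j.succ)]) (Finset.mem_univ i)
  have hB : 0 ≤ 6 * (L : ℝ) ^ 3 - timeCoupling su2Rep (P.1 (Fin.last (2 * L - 1))) (gaugeTransform P.2 (twist3 (fun _ => false) (P.1 0))) := by
    linarith [timeCoupling_su2Rep_le (P.1 (Fin.last (2 * L - 1))) (gaugeTransform P.2 (twist3 (fun _ => false) (P.1 0)))]
  have hC : 0 ≤ ∑ i : Fin (2 * L - 1), (1 / 2 : ℝ) * (wilsonAction su2Rep (P.1 i.castSucc) + wilsonAction su2Rep (P.1 i.succ)) :=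
    Finset.sum_nonneg fun j _ => by linarith [wilsonAction_su2_nonneg_lat (P.1 j.castSucc), wilsonAction_su2_nonneg_lat (P.1 j.succ)]
  have hD : 0 ≤ (1 / 2 : ℝ) * (wilsonAction su2Rep (P.1 (Fin.last (2 * L - 1))) + wilsonAction su2Rep (gaugeTransform P.2 (twist3 (fun _ => false) (P.1 0)))) := by
    linarith [wilsonAction_su2_nonneg_lat (P.1 (Fin.last (2 * L - 1))), wilsonAction_su2_nonneg_lat (gaugeTransform P.2 (twist3 (fun _ => false) (P.1 0)))]
  linarith

/-- The seam bond deficit is at most the total deficit. [folklore] -/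
theorem seam_le_ringDeficit (P : (Fin (2 * L - 1 + 1) → GaugeConfig 3 L SU2) × (Site 3 L → SU2)) :
    6 * (L : ℝ) ^ 3 - timeCoupling su2Rep (P.1 (Fin.last (2 * L - 1))) (gaugeTransform P.2 (P.1 0)) ≤ ringDeficit L (fun _ => false) P := by
  rw [ringDeficit_eq_sums, twist3_false]
  have hA : 0 ≤ ∑ i : Fin (2 * L - 1), (6 * (L : ℝ) ^ 3 - timeCoupling su2Rep (P.1 i.castSucc) (P.1 i.succ)) :=
    Finset.sum_nonneg fun j _ => by linarith [timeCoupling_su2Rep_le (P.1 j.castSucc) (P.1 j.succ)]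
  have hC : 0 ≤ ∑ i : Fin (2 * L - 1), (1 / 2 : ℝ) * (wilsonAction su2Rep (P.1 i.castSucc) + wilsonAction su2Rep (P.1 i.succ)) :=
    Finset.sum_nonneg fun j _ => by linarith [wilsonAction_su2_nonneg_lat (P.1 j.castSucc), wilsonAction_su2_nonneg_lat (P.1 j.succ)]
  have hD : 0 ≤ (1 / 2 : ℝ) * (wilsonAction su2Rep (P.1 (Fin.last (2 * L - 1))) + wilsonAction su2Rep (gaugeTransform P.2 (P.1 0))) := by
    linarith [wilsonAction_su2_nonneg_lat (P.1 (Fin.last (2 * L - 1))), wilsonAction_su2_nonneg_lat (gaugeTransform P.2 (P.1 0))]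
  linarith

/-- The spatial action of the first slice is at most twice the total deficit. [folklore] -/
theorem wilsonAction_first_le_ringDeficit (P : (Fin (2 * L - 1 + 1) → GaugeConfig 3 L SU2) × (Site 3 L → SU2)) :
    wilsonAction su2Rep (P.1 0) ≤ 2 * ringDeficit L (fun _ => false) P := by
  rw [ringDeficit_eq_sums, twist3_false]
  have hA : 0 ≤ ∑ i : Fin (2 * L - 1), (6 * (L : ℝ) ^ 3 - timeCoupling su2Rep (P.1 i.castSucc) (P.1 i.succ)) :=
    Finset.sum_nonneg fun j _ => by linarith [timeCoupling_su2Rep_le (P.1 j.castSucc) (P.1 j.succ)]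
  have hB : 0 ≤ 6 * (L : ℝ) ^ 3 - timeCoupling su2Rep (P.1 (Fin.last (2 * L - 1))) (gaugeTransform P.2 (P.1 0)) := by
    linarith [timeCoupling_su2Rep_le (P.1 (Fin.last (2 * L - 1))) (gaugeTransform P.2 (P.1 0))]
  have hC : 0 ≤ ∑ i : Fin (2 * L - 1), (1 / 2 : ℝ) * (wilsonAction su2Rep (P.1 i.castSucc) + wilsonAction su2Rep (P.1 i.succ)) :=
    Finset.sum_nonneg fun j _ => by linarith [wilsonAction_su2_nonneg_lat (P.1 j.castSucc), wilsonAction_su2_nonneg_lat (P.1 j.succ)]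
  have hS : wilsonAction su2Rep (gaugeTransform P.2 (P.1 0)) = wilsonAction su2Rep (P.1 0) := wilsonAction_gaugeTransform _ _ _
  have hl : 0 ≤ wilsonAction su2Rep (P.1 (Fin.last (2 * L - 1))) := wilsonAction_su2_nonneg_lat _
  rw [hS]
  linarith


/-! ## §2 Per-link consequences of a small deficit -/

/-- Consecutive slices are `2√F₀`-close on every link. [folklore] -/
theorem fd_step_le (P : (Fin (2 * L - 1 + 1) → GaugeConfig 3 L SU2) × (Site 3 L → SU2)) (i : Fin (2 * L - 1)) (e : Edge 3 L) :
    fd (P.1 i.castSucc e) (P.1 i.succ e) ≤ 2 * Real.sqrt (ringDeficit L (fun _ => false) P) := by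
  have h1 := norm_sq_le_timeCoupling_deficit (P.1 i.castSucc) (P.1 i.succ) e
  have h2 := kinetic_le_ringDeficit P i
  have h3 : ‖su2Quat (P.1 i.castSucc e) - su2Quat (P.1 i.succ e)‖ ≤ Real.sqrt (ringDeficit L (fun _ => false) P) :=
    Real.le_sqrt_of_sq_le (by linarith)
  linarith [fd_le_two_mul_norm_su2Quat_sub (P.1 i.castSucc e) (P.1 i.succ e)]

/-- Every slice is within `k·2√F₀` of slice `0` on every link (`k` = its index). [folklore] -/
theorem fd_slice_zero_le (P : (Fin (2 * L - 1 + 1) → GaugeConfig 3 L SU2) × (Site 3 L → SU2)) (e : Edge 3 L) :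
    ∀ (k : ℕ) (hk : k < 2 * L - 1 + 1), fd (P.1 ⟨k, hk⟩ e) (P.1 0 e) ≤ k * (2 * Real.sqrt (ringDeficit L (fun _ => false) P)) := by
  intro k
  induction k with
  | zero => intro hk; simp [show (⟨0, hk⟩ : Fin (2 * L - 1 + 1)) = 0 from rfl, fd_self]
  | succ k ih =>
    intro hk
    have hk' : k < 2 * L - 1 := by omega
    have hs := fd_step_le P ⟨k, hk'⟩ e
    have e1 : (⟨k, hk'⟩ : Fin (2 * L - 1)).castSucc = ⟨k, by omega⟩ := rfl
    have e2 : (⟨k, hk'⟩ : Fin (2 * L - 1)).succ = ⟨k + 1, hk⟩ := rfl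
    rw [e1, e2] at hs
    have := ih (by omega)
    rw [fd_comm] at hs
    push_cast
    linarith [fd_triangle (P.1 ⟨k + 1, hk⟩ e) (P.1 ⟨k, by omega⟩ e) (P.1 0 e)]

/-- Every slice is within `4L√F₀` of slice `0` on every link. [folklore] -/
theorem fd_slice_zero_le' (P : (Fin (2 * L - 1 + 1) → GaugeConfig 3 L SU2) × (Site 3 L → SU2)) (i : Fin (2 * L - 1 + 1)) (e : Edge 3 L) :
    fd (P.1 i e) (P.1 0 e) ≤ 4 * (L : ℝ) * Real.sqrt (ringDeficit L (fun _ => false) P) := by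
  have h := fd_slice_zero_le P e i.val i.isLt
  have hi : (i.val : ℝ) ≤ 2 * (L : ℝ) := by
    have : i.val ≤ 2 * L := by omega
    exact_mod_cast this
  have hs := Real.sqrt_nonneg (ringDeficit L (fun _ => false) P)
  calc fd (P.1 i e) (P.1 0 e) = fd (P.1 ⟨i.val, i.isLt⟩ e) (P.1 0 e) := rfl
    _ ≤ i.val * (2 * Real.sqrt (ringDeficit L (fun _ => false) P)) := h
    _ ≤ 2 * (L : ℝ) * (2 * Real.sqrt (ringDeficit L (fun _ => false) P)) := mul_le_mul_of_nonneg_right hi (by positivity)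
    _ = 4 * (L : ℝ) * Real.sqrt (ringDeficit L (fun _ => false) P) := by ring

/-- The seam gauge field moves slice `0` by at most `ρ = 4L√F₀` on every link. [folklore] -/
theorem fd_seam_zero_le (P : (Fin (2 * L - 1 + 1) → GaugeConfig 3 L SU2) × (Site 3 L → SU2)) (e : Edge 3 L) :
    fd (P.1 0 e) (gaugeTransform P.2 (P.1 0) e) ≤ 4 * (L : ℝ) * Real.sqrt (ringDeficit L (fun _ => false) P) := by
  set r := Real.sqrt (ringDeficit L (fun _ => false) P) with hr
  have hs : 0 ≤ r := Real.sqrt_nonneg _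
  -- last slice vs seam image
  have h1 := norm_sq_le_timeCoupling_deficit (P.1 (Fin.last (2 * L - 1))) (gaugeTransform P.2 (P.1 0)) e
  have h2 := seam_le_ringDeficit P
  have h3 : ‖su2Quat (P.1 (Fin.last (2 * L - 1)) e) - su2Quat (gaugeTransform P.2 (P.1 0) e)‖ ≤ r := Real.le_sqrt_of_sq_le (by linarith)
  have h4 : fd (P.1 (Fin.last (2 * L - 1)) e) (gaugeTransform P.2 (P.1 0) e) ≤ 2 * r := by
    linarith [fd_le_two_mul_norm_su2Quat_sub (P.1 (Fin.last (2 * L - 1)) e) (gaugeTransform P.2 (P.1 0) e)]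
  -- last slice vs slice 0
  have h5 := fd_slice_zero_le P e (2 * L - 1) (by omega)
  have e5 : (⟨2 * L - 1, by omega⟩ : Fin (2 * L - 1 + 1)) = Fin.last (2 * L - 1) := rfl
  rw [e5] at h5
  have hL1 : 1 ≤ L := NeZero.one_le
  have hN : (((2 * L - 1 : ℕ) : ℝ)) = 2 * (L : ℝ) - 1 := by rw [Nat.cast_sub (by omega), Nat.cast_mul]; push_cast; ring
  rw [hN, fd_comm] at h5
  calc fd (P.1 0 e) (gaugeTransform P.2 (P.1 0) e)
      ≤ fd (P.1 0 e) (P.1 (Fin.last (2 * L - 1)) e) + fd (P.1 (Fin.last (2 * L - 1)) e) (gaugeTransform P.2 (P.1 0) e) := fd_triangle _ _ _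
    _ ≤ (2 * (L : ℝ) - 1) * (2 * r) + 2 * r := add_le_add h5 h4
    _ = 4 * (L : ℝ) * r := by ring

/-- `√(2S(P₀)) ≤ 2√F₀`. [folklore] -/
theorem sqrt_two_action_le (P : (Fin (2 * L - 1 + 1) → GaugeConfig 3 L SU2) × (Site 3 L → SU2)) :
    Real.sqrt (2 * wilsonAction su2Rep (P.1 0)) ≤ 2 * Real.sqrt (ringDeficit L (fun _ => false) P) := by
  have h := wilsonAction_first_le_ringDeficit P
  have h4 : 2 * wilsonAction su2Rep (P.1 0) ≤ 2 ^ 2 * ringDeficit L (fun _ => false) P := by linarith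
  calc Real.sqrt (2 * wilsonAction su2Rep (P.1 0)) ≤ Real.sqrt (2 ^ 2 * ringDeficit L (fun _ => false) P) := Real.sqrt_le_sqrt h4
    _ = 2 * Real.sqrt (ringDeficit L (fun _ => false) P) := by
        rw [Real.sqrt_mul (by norm_num), Real.sqrt_sq (by norm_num)]

/-! ## §3 Gauge bookkeeping on single links -/

omit [NeZero L] in
/-- Per-link gauge invariance of the link distance. [folklore] -/
theorem fd_gaugeTransform_apply (t : Site 3 L → SU2) (A B : GaugeConfig 3 L SU2) (e : Edge 3 L) :
    fd (gaugeTransform t A e) (gaugeTransform t B e) = fd (A e) (B e) := by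
  simp only [gaugeTransform]
  rw [fd_mul_right, fd_mul_left]

omit [NeZero L] in
/-- The conjugated seam field acts on the comb-gauge slice as the seam field acts on the slice: `(tgt⁻¹)·(t·U) = t·(g·U)`. [folklore] -/
theorem gaugeTransform_conj_eq (t g : Site 3 L → SU2) (U : GaugeConfig 3 L SU2) :
    gaugeTransform (fun x => t x * g x * (t x)⁻¹) (gaugeTransform t U) = gaugeTransform t (gaugeTransform g U) := by
  rw [gaugeTransform_gaugeTransform, gaugeTransform_gaugeTransform]
  congr 1
  funext x
  simp only [Pi.mul_apply, inv_mul_cancel_right]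

omit [NeZero L] in
/-- The three wrap representatives sit on edges ending at the origin. [folklore] -/
theorem wrapEdge_shift (k : Fin 3) :
    Site.shift (mk3 (if k = 0 then (-1 : ZMod L) else 0) (if k = 1 then (-1 : ZMod L) else 0) (if k = 2 then (-1 : ZMod L) else 0)) k = 0 := by
  rw [mk3_shift]
  have h0 : (mk3 0 0 0 : Site 3 L) = 0 := by funext j; fin_cases j <;> rfl
  fin_cases k <;> simp [h0]

omit [NeZero L] in
/-- `wrapReps U k` is the comb-gauge link on the wrap edge of direction `k` through the corner. [folklore] -/
theorem wrapReps_eq (U : GaugeConfig 3 L SU2) (k : Fin 3) :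
    wrapReps U k = treeFix U (mk3 (if k = 0 then (-1 : ZMod L) else 0) (if k = 1 then (-1 : ZMod L) else 0) (if k = 2 then (-1 : ZMod L) else 0), k) := by
  fin_cases k <;> rfl


end Summit.QuantumFields.YangMills.Theorems.ToronValleyVolume.Lojasiewicz

end
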